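import Summits.RiemannHypothesis.RiemannHypothesis.Theorems.SemilocalDeletionCliff
import Summits.RiemannHypothesis.RiemannHypothesis.Theorems.HandoffSemilocalEnergy
import HarnessLib

/-!
# The TOEPLITZ FLOOR of the prime-deletion cliff: one prime with SEVERAL visible powers

`SemilocalDeletionCliff.lean` (p362953) proved the single-atom floor: deleting a prime `p ∈ S` from the semi-local Weil form on a
window `[−c, c]` with `c < log p` lowers every bottom by at most `w₁ = log p/√p`, attained on antisymmetric dipoles
(`SemilocalDeletionDipole.lean`).  When the window grows past `log p` the powers `p², p³, …` become visible too
(`m` atoms: `m·log p < 2c < (m+1)·log p`) and the deleted perturbation is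

  `Q_{S∖p}(g) − Q_S(g) = Σ_{d=1}^{m} w_d·(k(dL) + k(−dL))`,  `w_d = log p/√(p^d)`, `L = log p`, `k = g ⋆ g̃`

(`weilSemilocalQuadratic_sub_erase_pow`, §2).  The lags are COMMENSURATE, so the window splits into the cells
`I_i = [−c + iL, −c + (i+1)L)`, `i = 0 … m`, and on each fibre `v ∈ I_0` the perturbation is the Hermitian form of the
zero-diagonal Toeplitz matrix `A_m(p) = [L·p^{−|i−j|/2}]_{i≠j}` (a Kac–Murdock–Szegő matrix minus its diagonal) in the vector
`(g(v + iL))_i` (§3: `integral_norm_sq_eq_sum_cells`, `weilConv_weilReflect_eq_sum_cells`).  Hence (§4, §5):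

* `re_weilSemilocalQuadratic_erase_ge_of_cert` / `semilocalGroundEnergy_erase_ge_of_cert` — **TOEPLITZ FLOOR**: if
  `A_m(p) + μ·I ⪰ 0` (stated as a fibre certificate: the form is `≥ 0` on every `G : ℤ → ℂ` supported in `{0,…,m}`), then
  `Re Q_{S∖p}(g) ≥ Re Q_S(g) − μ‖g‖₂²` and `λ_min(S∖p; c; P) ≥ λ_min(S; c; P) − μ` for every finite `S ∋ p`, every constraint `P`.
  The best constant is `μ = −λ_min(A_m(p))`; closed forms and the kernel-free certificates for `m = 1, 2` are in
  `SemilocalDeletionToeplitzFloorTwo.lean` (`m = 1`: `μ = w₁`, the cliff; `m = 2`: `μ₂(p) = (log p/2p)(√(1+8p) − 1)`, `= 2·log 3/3` at `p = 3`).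

THE LAW IT PROVES THE FLOOR OF (lineage-E certified cells, EXTREMALS/semilocal/Shier-E-v8, `S = U(b)∖{p}`, `U(b)` = all primes
`≤ e^{2b}`, N = 120/200/400/800, b = 0.85 … 1.9, p = 2, 3, 5, 7, 11 — 0 violations, and CONVERGENCE to the floor with the room
`c − mL/2`, the fast sector alternating with `m`):  `λ_min(U(b)∖{p}; b) = λ_min(A_m(p)) + Δ`, `Δ ≥ 0`, `Δ → 0`:
`p = 2`: `m = 2 → −0.541193` (data `−0.540501` at `b = 1.0`), `m = 3 → −0.556336` (`−0.556173` at `1.35`), `m = 4 → −0.562940`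
(`−0.562899` at `1.7`); `p = 3`: `m = 2 → −2·log 3/3 = −0.732408` (data `−0.732407` at `b = 1.55`), `m = 3 → −0.764278`;
`p = 5`: `m = 2 → −0.869599`; `m = 1` is the cliff `−log p/√p` (p = 5, 7, 11 cells to `1e−11 … 1e−14`).  As `m → ∞` the floor tends to
`−2·log p/(1 + √p)` (the KMS symbol at `θ = π`).  So single SMALL-prime deletions — where the orbit-graph/Schur floors of
`SemilocalDeletionSchurFloor.lean` are slack by a factor ≈ 2 — are governed EXACTLY by a finite Toeplitz section.

Nothing here bears on RH; these are statements about truncated Weil forms.  [KMS: M. Kac, W. L. Murdock, G. Szegő, *On the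
eigenvalues of certain Hermitian forms*, J. Rational Mech. Anal. 2 (1953) — the matrix `[r^{|i−j|}]`; used here only as a name.]


Sequel files on the same floor (cc-s2-1 gen12, filed as this module's olean allows): `…ToeplitzFloorUniform` (all-window floor
`2·log p/(√p+1)`), `…ToeplitzCeiling` (ceiling `2·log p/(√p−1)`), `…ToeplitzFloorTwo/Dyadic/DyadicHigh/Triadic` (sharp certificates),
`…ToeplitzHalfRoom/Combs/CombsLinear` (convergence half), `SemilocalDeletionAllWindowModulus` (Lipschitz law in the prime set).
-/

set_option linter.dupNamespace false

noncomputable section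

open Complex Filter Set MeasureTheory
open scoped Real Topology ComplexConjugate

namespace Summit.RiemannHypothesis.RiemannHypothesis.Theorems.SemilocalDeletionToeplitzFloor

open Literature.NumberTheory.LFunctions

/-! ## §1  Cells: cutting `[a, a + nL)` into translates of `[a, a + L)` -/

variable {E : Type*} [NormedAddCommGroup E] [NormedSpace ℝ E]

omit [NormedSpace ℝ E] in
/-- Partition of `[a, a + nL)` into the cells `[a + iL, a + (i+1)L)`, `i < n`, at the level of indicators. -/
theorem sum_indicator_cells (F : ℝ → E) (a : ℝ) {L : ℝ} (hL : 0 ≤ L) (n : ℕ) (u : ℝ) :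
    ∑ i ∈ Finset.range n, (Ico (a + i * L) (a + (i + 1) * L)).indicator F u = (Ico a (a + n * L)).indicator F u := by
  induction n with
  | zero => simp
  | succ n ih =>
    rw [Finset.sum_range_succ, ih]
    have hdisj : Disjoint (Ico a (a + n * L)) (Ico (a + n * L) (a + (n + 1) * L)) :=
      Ico_disjoint_Ico_same
    have hun : Ico a (a + n * L) ∪ Ico (a + n * L) (a + (n + 1) * L) = Ico a (a + ((n + 1 : ℕ) : ℝ) * L) := by
      push_cast
      exact Ico_union_Ico_eq_Ico (by nlinarith) (by nlinarith)
    rw [← hun, Set.indicator_union_of_disjoint hdisj]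

/-- **Cell decomposition of an integral.** If `F` vanishes off `[a, a + nL)` (`L > 0`), then
`∫ F = Σ_{i<n} ∫_{[a, a+L)} F(v + iL) dv`: cut the interval into `n` cells and translate each back to the first. -/
theorem integral_eq_sum_integral_cells {F : ℝ → E} (hF : Integrable F) (a : ℝ) {L : ℝ} (hL : 0 < L) (n : ℕ)
    (hzero : ∀ u, u ∉ Ico a (a + n * L) → F u = 0) :
    ∫ u, F u = ∑ i ∈ Finset.range n, ∫ v in Ico a (a + L), F (v + i * L) := by
  have hFeq : F = fun u ↦ ∑ i ∈ Finset.range n, (Ico (a + i * L) (a + (i + 1) * L)).indicator F u := by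
    funext u
    rw [sum_indicator_cells F a hL.le n u]
    by_cases hu : u ∈ Ico a (a + n * L)
    · rw [Set.indicator_of_mem hu]
    · rw [Set.indicator_of_notMem hu, hzero u hu]
  have hint : ∀ i ∈ Finset.range n, Integrable ((Ico (a + i * L) (a + (i + 1) * L)).indicator F) :=
    fun i _ ↦ hF.indicator measurableSet_Ico
  calc ∫ u, F u = ∫ u, ∑ i ∈ Finset.range n, (Ico (a + i * L) (a + (i + 1) * L)).indicator F u := by rw [← hFeq]
    _ = ∑ i ∈ Finset.range n, ∫ u, (Ico (a + i * L) (a + (i + 1) * L)).indicator F u := integral_finsetSum _ hint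
    _ = ∑ i ∈ Finset.range n, ∫ v in Ico a (a + L), F (v + i * L) := by
        refine Finset.sum_congr rfl fun i _ ↦ ?_
        rw [← integral_add_right_eq_self _ ((i : ℝ) * L), ← integral_indicator measurableSet_Ico]
        refine integral_congr_ae (Eventually.of_forall fun v ↦ ?_)
        show (Ico (a + i * L) (a + (i + 1) * L)).indicator F (v + i * L) =
          (Ico a (a + L)).indicator (fun v ↦ F (v + i * L)) v
        have hiff : v + i * L ∈ Ico (a + i * L) (a + (i + 1) * L) ↔ v ∈ Ico a (a + L) := by
          simp only [mem_Ico]; constructor <;> rintro ⟨h1, h2⟩ <;> constructor <;> nlinarith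
        by_cases hv : v ∈ Ico a (a + L)
        · rw [Set.indicator_of_mem (hiff.2 hv), Set.indicator_of_mem hv]
        · rw [Set.indicator_of_notMem (fun h ↦ hv (hiff.1 h)), Set.indicator_of_notMem hv]


open Summit.RiemannHypothesis.RiemannHypothesis.Theorems.SemilocalDeletionCliff

variable {g : ℝ → ℂ}

/-! ## §2  Deleting one prime with several visible powers: the exact perturbation -/

/-- At every power of the deleted prime: `Λ_S(p^d)/√(p^d) − Λ_{S∖p}(p^d)/√(p^d) = log p/√(p^d)` (`d ≠ 0`, `p ∈ S`). -/
theorem weilSemilocalCoeff_sub_erase_pow {S : Finset ℕ} {p d : ℕ} (hp : p.Prime) (hpS : p ∈ S) (hd : d ≠ 0) :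
    weilSemilocalCoeff S (p ^ d) - weilSemilocalCoeff (S.erase p) (p ^ d) = Real.log p / Real.sqrt ((p : ℝ) ^ d) := by
  unfold weilSemilocalCoeff
  have h1 : (p ^ d).primeFactors ⊆ S := by
    rw [Nat.primeFactors_prime_pow hd hp, Finset.singleton_subset_iff]; exact hpS
  have h2 : ¬ (p ^ d).primeFactors ⊆ S.erase p := by
    rw [Nat.primeFactors_prime_pow hd hp, Finset.singleton_subset_iff]; exact Finset.notMem_erase p S
  rw [if_pos h1, if_neg h2, ArithmeticFunction.vonMangoldt_apply_pow hd, ArithmeticFunction.vonMangoldt_apply_prime hp,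
    sub_zero]
  push_cast
  rfl

/-- **Deleting one prime with several visible powers, exactly.** For `p ∈ S` prime and a test function on `[−c, c]` with
`2c < (m+1)·log p` (at most the powers `p, p², …, p^m` are visible in the window of `k = g ⋆ g̃`):
`Q_S(g) − Q_{S∖{p}}(g) = −Σ_{d=1}^{m} (log p/√(p^d))·(k(d·log p) + k(−d·log p))`. -/
theorem weilSemilocalQuadratic_sub_erase_pow (hg : IsWeilTest g) {S : Finset ℕ} {p : ℕ} (hp : p.Prime) (hpS : p ∈ S)
    {c : ℝ} (hsupp : tsupport g ⊆ Icc (-c) c) {m : ℕ} (hm : 2 * c < (m + 1) * Real.log p) :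
    weilSemilocalQuadratic S g - weilSemilocalQuadratic (S.erase p) g =
      -∑ d ∈ Finset.range m, ((Real.log p / Real.sqrt ((p : ℝ) ^ (d + 1)) : ℝ) : ℂ) *
        (weilConv g (weilReflect g) ((d + 1) * Real.log p) + weilConv g (weilReflect g) (-((d + 1) * Real.log p))) := by
  set k := weilConv g (weilReflect g) with hkdef
  have hk : IsWeilTest k := hg.weilConv hg.weilReflect
  have hp1 : 1 < p := hp.one_lt
  have hlp : 0 < Real.log p := Real.log_pos (by exact_mod_cast hp1)
  -- a window index `N` with `2c < log (N + 1)` and `p ^ m ≤ N`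
  obtain ⟨N, hN, hpmN⟩ : ∃ N : ℕ, Real.exp (2 * c) < (N : ℝ) + 1 ∧ p ^ m ≤ N := by
    obtain ⟨N, hN⟩ := exists_nat_gt (Real.exp (2 * c))
    refine ⟨max N (p ^ m), ?_, le_max_right _ _⟩
    have : (N : ℝ) ≤ ((max N (p ^ m) : ℕ) : ℝ) := by exact_mod_cast le_max_left _ _
    linarith
  have hlogN : 2 * c < Real.log ((N : ℝ) + 1) := by
    rw [Real.lt_log_iff_exp_lt (by positivity)]; exact hN
  have hks : tsupport k ⊆ Icc (-Real.log ((N : ℝ) + 1)) (Real.log ((N : ℝ) + 1)) :=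
    (tsupport_weilConv_weilReflect_subset (a := c) hg.2 hsupp).trans (Icc_subset_Icc (by linarith) (by linarith))
  have hS := weilSemilocalPrimeTerm_eq_sum_of_tsupport_subset S hk.1.continuous N hks
  have hS' := weilSemilocalPrimeTerm_eq_sum_of_tsupport_subset (S.erase p) hk.1.continuous N hks
  -- the summand of the difference of the two finite prime sums
  set f : ℕ → ℂ := fun n ↦ ((weilSemilocalCoeff S n : ℂ) - (weilSemilocalCoeff (S.erase p) n : ℂ)) *
    (k (Real.log n) + k (-Real.log n)) with hf
  -- the atoms p^(d+1), d < m, index the nonzero summands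
  set ι : ℕ → ℕ := fun d ↦ p ^ (d + 1) with hι
  have hιinj : Function.Injective ι := fun a b h ↦ by
    have := Nat.pow_right_injective hp.two_le h
    omega
  have himg : (Finset.range m).image ι ⊆ Finset.range (N + 1) := by
    intro n hn
    obtain ⟨d, hd, rfl⟩ := Finset.mem_image.1 hn
    rw [Finset.mem_range] at hd ⊢
    have : p ^ (d + 1) ≤ p ^ m := Nat.pow_le_pow_right hp.pos (by omega)
    show p ^ (d + 1) < N + 1
    omega
  have hvanish : ∀ n ∈ Finset.range (N + 1), n ∉ (Finset.range m).image ι → f n = 0 := by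
    intro n _ hn
    simp only [hf]
    by_cases hpp : IsPrimePow n
    · obtain ⟨q, j, hq, hj, rfl⟩ := (isPrimePow_nat_iff _).1 hpp
      by_cases hqp : q = p
      · subst hqp
        -- then j > m (else n would be in the image), so both k-values vanish
        have hjm : m < j := by
          by_contra h
          push Not at h
          refine hn (Finset.mem_image.2 ⟨j - 1, ?_, ?_⟩)
          · rw [Finset.mem_range]; omega
          · simp only [hι]; congr 1; omega
        have hlog : 2 * c < |Real.log ((q ^ j : ℕ) : ℝ)| := by
          push_cast
          rw [Real.log_pow, abs_of_nonneg (by positivity)]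
          have : ((m : ℝ) + 1) * Real.log q ≤ j * Real.log q :=
            mul_le_mul_of_nonneg_right (by exact_mod_cast hjm) hlp.le
          linarith
        have h1 : k (Real.log ((q ^ j : ℕ) : ℝ)) = 0 := weilConv_weilReflect_eq_zero_of_lt hg hsupp hlog
        have h2 : k (-Real.log ((q ^ j : ℕ) : ℝ)) = 0 :=
          weilConv_weilReflect_eq_zero_of_lt hg hsupp (by rwa [abs_neg])
        rw [h1, h2]
        ring
      · rw [weilSemilocalCoeff_erase_prime_pow_of_ne S hq hj.ne' hqp]; ring
    · rw [weilSemilocalCoeff_of_not_isPrimePow S hpp, weilSemilocalCoeff_of_not_isPrimePow (S.erase p) hpp]; ring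
  have hdiff : weilSemilocalPrimeTerm S k - weilSemilocalPrimeTerm (S.erase p) k =
      ∑ d ∈ Finset.range m, ((Real.log p / Real.sqrt ((p : ℝ) ^ (d + 1)) : ℝ) : ℂ) *
        (k ((d + 1) * Real.log p) + k (-((d + 1) * Real.log p))) := by
    rw [hS, hS', ← Finset.sum_sub_distrib]
    have e1 : ∑ n ∈ Finset.range (N + 1), ((weilSemilocalCoeff S n : ℂ) * (k (Real.log n) + k (-Real.log n)) -
        (weilSemilocalCoeff (S.erase p) n : ℂ) * (k (Real.log n) + k (-Real.log n))) = ∑ n ∈ Finset.range (N + 1), f n :=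
      Finset.sum_congr rfl fun n _ ↦ by simp only [hf]; ring
    rw [e1, ← Finset.sum_subset himg hvanish, Finset.sum_image fun a _ b _ h ↦ hιinj h]
    refine Finset.sum_congr rfl fun d _ ↦ ?_
    simp only [hf, hι]
    have hd1 : d + 1 ≠ 0 := by omega
    rw [← Complex.ofReal_sub, weilSemilocalCoeff_sub_erase_pow hp hpS hd1]
    push_cast
    rw [Real.log_pow]
    push_cast
    ring_nf
  unfold weilSemilocalQuadratic weilSemilocalFunctional
  rw [← hkdef]
  linear_combination (-1 : ℂ) * hdiff


open Summit.RiemannHypothesis.RiemannHypothesis.Theorems.HandoffSemilocalEnergy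

variable {g : ℝ → ℂ}

/-! ## §3  Fibres: the window's norm and autocorrelations as sums over the cells `[−c + iL, −c + (i+1)L)` -/

/-- A test function on `[−c, c]` vanishes off the window. -/
theorem apply_eq_zero_of_not_mem {c u : ℝ} (hsupp : tsupport g ⊆ Icc (-c) c) (hu : u ∉ Icc (-c) c) : g u = 0 := by
  by_contra h
  exact hu (hsupp (subset_tsupport _ (Function.mem_support.2 h)))

/-- Shifted products `v ↦ g(v + s)·conj g(v + t)` of a test function are integrable. -/
theorem integrable_shift_mul_conj_shift (hg : IsWeilTest g) (s t : ℝ) :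
    Integrable fun v : ℝ ↦ g (v + s) * conj (g (v + t)) := by
  have hc : Continuous fun v : ℝ ↦ g (v + s) * conj (g (v + t)) := by
    have := hg.1.continuous
    fun_prop
  have hs : HasCompactSupport fun v : ℝ ↦ g (v + s) :=
    hg.2.comp_homeomorph (Homeomorph.addRight s)
  exact hc.integrable_of_hasCompactSupport hs.mul_right

/-- **Norm fibre identity.** For `tsupport g ⊆ [−c, c]` and `2c < (m+1)L`, `L > 0`:
`‖g‖₂² = Σ_{i ≤ m} ∫_{[−c, −c+L)} |g(v + iL)|² dv`. -/
theorem integral_norm_sq_eq_sum_cells (hg : IsWeilTest g) {c L : ℝ} (hsupp : tsupport g ⊆ Icc (-c) c) (hL : 0 < L)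
    {m : ℕ} (hm : 2 * c < (m + 1) * L) :
    ∫ u, ‖g u‖ ^ 2 = ∑ i ∈ Finset.range (m + 1), ∫ v in Ico (-c) (-c + L), ‖g (v + i * L)‖ ^ 2 := by
  refine integral_eq_sum_integral_cells hg.integrable_norm_sq (-c) hL (m + 1) fun u hu ↦ ?_
  have hu' : u ∉ Icc (-c) c := fun h ↦ hu ⟨h.1, by push_cast; linarith [h.2]⟩
  rw [apply_eq_zero_of_not_mem hsupp hu', norm_zero, zero_pow two_ne_zero]

/-- **Autocorrelation fibre identity.** For `tsupport g ⊆ [−c, c]`, `2c < (m+1)L`, `L > 0`, and any shift `x`: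
`k(x) = ∫ g(u) conj g(u − x) du = Σ_{i ≤ m} ∫_{[−c, −c+L)} g(v + iL) conj g(v + iL − x) dv`. -/
theorem weilConv_weilReflect_eq_sum_cells (hg : IsWeilTest g) {c L : ℝ} (hsupp : tsupport g ⊆ Icc (-c) c) (hL : 0 < L)
    {m : ℕ} (hm : 2 * c < (m + 1) * L) (x : ℝ) :
    weilConv g (weilReflect g) x =
      ∑ i ∈ Finset.range (m + 1), ∫ v in Ico (-c) (-c + L), g (v + i * L) * conj (g (v + i * L - x)) := by
  have happ : weilConv g (weilReflect g) x = ∫ u, g u * conj (g (u - x)) := by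
    rw [weilConv_apply]
    refine integral_congr_ae (Eventually.of_forall fun u ↦ ?_)
    simp only [weilReflect, neg_sub]
  rw [happ]
  have hint : Integrable fun u : ℝ ↦ g u * conj (g (u - x)) := by
    have := integrable_shift_mul_conj_shift hg 0 (-x)
    simp only [add_zero, ← sub_eq_add_neg] at this
    exact this
  refine integral_eq_sum_integral_cells hint (-c) hL (m + 1) fun u hu ↦ ?_
  have hu' : u ∉ Icc (-c) c := fun h ↦ hu ⟨h.1, by push_cast; linarith [h.2]⟩
  rw [apply_eq_zero_of_not_mem hsupp hu', zero_mul]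

/-! ## §4  The Toeplitz floor: a fibre certificate bounds the whole deletion perturbation -/

/-- **TOEPLITZ FLOOR (certificate form).** Let `p ∈ S` be prime, `L = log p`, `tsupport g ⊆ [−c, c]` with `2c < (m+1)L` (at most the
atoms `p, …, p^m` are visible), and let `μ` satisfy the FIBRE CERTIFICATE: for every `G : ℤ → ℂ` supported in `{0, …, m}`,
`0 ≤ μ Σ_i |G_i|² + Σ_{d=1}^{m} (L/√(p^d)) Σ_i Re(G_i conj G_{i−d} + G_i conj G_{i+d})` — i.e. the zero-diagonal Toeplitz matrix
`A_m(p) = [L·p^{−|i−j|/2}]_{i≠j}` satisfies `A_m(p) + μ·I ⪰ 0`.  Then `Re Q_{S∖{p}}(g) ≥ Re Q_S(g) − μ‖g‖₂²`. -/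
theorem re_weilSemilocalQuadratic_erase_ge_of_cert (hg : IsWeilTest g) {S : Finset ℕ} {p : ℕ} (hp : p.Prime) (hpS : p ∈ S)
    {c : ℝ} (hsupp : tsupport g ⊆ Icc (-c) c) {m : ℕ} (hm : 2 * c < (m + 1) * Real.log p) {μ : ℝ}
    (hcert : ∀ G : ℤ → ℂ, (∀ n : ℤ, n < 0 → G n = 0) → (∀ n : ℤ, (m : ℤ) < n → G n = 0) →
      0 ≤ μ * ∑ i ∈ Finset.range (m + 1), ‖G i‖ ^ 2 +
        ∑ e ∈ Finset.range m, Real.log p / Real.sqrt ((p : ℝ) ^ (e + 1)) *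
          ∑ i ∈ Finset.range (m + 1), (G i * conj (G ((i : ℤ) - (e + 1))) + G i * conj (G ((i : ℤ) + (e + 1)))).re) :
    (weilSemilocalQuadratic S g).re - μ * ∫ u : ℝ, ‖g u‖ ^ 2 ≤ (weilSemilocalQuadratic (S.erase p) g).re := by
  set L := Real.log p with hLdef
  have hL : 0 < L := Real.log_pos (by exact_mod_cast hp.one_lt)
  set k := weilConv g (weilReflect g) with hkdef
  set w : ℕ → ℝ := fun d ↦ Real.log p / Real.sqrt ((p : ℝ) ^ d) with hwdef
  -- the perturbation and the deletion identity
  set P : ℂ := ∑ e ∈ Finset.range m, ((w (e + 1) : ℝ) : ℂ) * (k ((e + 1) * L) + k (-((e + 1) * L))) with hPdef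
  have hid : weilSemilocalQuadratic (S.erase p) g = weilSemilocalQuadratic S g + P := by
    have h := weilSemilocalQuadratic_sub_erase_pow hg hp hpS hsupp hm
    rw [← hkdef] at h
    linear_combination (-1 : ℂ) * h
  -- fibre integrands
  set I₀ := Ico (-c) (-c + L) with hI₀
  set T : ℕ → ℕ → ℝ → ℂ := fun e i v ↦
    g (v + i * L) * conj (g (v + i * L - (e + 1) * L)) + g (v + i * L) * conj (g (v + i * L + (e + 1) * L)) with hTdef
  have hTi : ∀ e i, Integrable (T e i) := fun e i ↦ by
    have h1 := integrable_shift_mul_conj_shift hg (i * L) (i * L - (e + 1) * L)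
    have h2 := integrable_shift_mul_conj_shift hg (i * L) (i * L + (e + 1) * L)
    have hT : T e i = (fun v ↦ g (v + i * L) * conj (g (v + (i * L - (e + 1) * L)))) +
        fun v ↦ g (v + i * L) * conj (g (v + (i * L + (e + 1) * L))) := by
      funext v
      simp only [hTdef, Pi.add_apply, add_sub_assoc, add_assoc]
    rw [hT]
    exact h1.add h2
  have hTre : ∀ e i, Integrable fun v ↦ (T e i v).re := fun e i ↦ (hTi e i).re
  have hNi : ∀ i : ℕ, Integrable fun v : ℝ ↦ ‖g (v + i * L)‖ ^ 2 := fun i ↦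
    hg.integrable_norm_sq.comp_add_right ((i : ℝ) * L)
  set Φ : ℝ → ℝ := fun v ↦ μ * ∑ i ∈ Finset.range (m + 1), ‖g (v + i * L)‖ ^ 2 +
    ∑ e ∈ Finset.range m, w (e + 1) * ∑ i ∈ Finset.range (m + 1), (T e i v).re with hΦdef
  -- (A) the fibre integral of Φ is μ‖g‖² + Re P
  have hnorm : ∫ u, ‖g u‖ ^ 2 = ∫ v in I₀, ∑ i ∈ Finset.range (m + 1), ‖g (v + i * L)‖ ^ 2 := by
    rw [integral_finsetSum (Finset.range (m + 1)) fun i _ ↦ (hNi i).integrableOn,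
      integral_norm_sq_eq_sum_cells hg hsupp hL hm]
  have hP : P = ∑ e ∈ Finset.range m, ((w (e + 1) : ℝ) : ℂ) * ∑ i ∈ Finset.range (m + 1), ∫ v in I₀, T e i v := by
    refine Finset.sum_congr rfl fun e _ ↦ ?_
    congr 1
    rw [hkdef, weilConv_weilReflect_eq_sum_cells hg hsupp hL hm, weilConv_weilReflect_eq_sum_cells hg hsupp hL hm,
      ← Finset.sum_add_distrib]
    refine Finset.sum_congr rfl fun i _ ↦ ?_
    rw [← integral_add]
    · refine setIntegral_congr_fun measurableSet_Ico fun v _ ↦ ?_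
      simp only [hTdef, sub_neg_eq_add]
    · have := integrable_shift_mul_conj_shift hg (i * L) (i * L - (e + 1) * L)
      exact (this.congr (Eventually.of_forall fun v ↦ by rw [add_sub_assoc])).integrableOn
    · have := integrable_shift_mul_conj_shift hg (i * L) (i * L + (e + 1) * L)
      exact (this.congr (Eventually.of_forall fun v ↦ by rw [sub_neg_eq_add, add_assoc])).integrableOn
  have hPre : P.re = ∫ v in I₀, ∑ e ∈ Finset.range m, w (e + 1) * ∑ i ∈ Finset.range (m + 1), (T e i v).re := by
    rw [hP, Complex.re_sum, integral_finsetSum _ fun e _ ↦ ?_]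
    · refine Finset.sum_congr rfl fun e _ ↦ ?_
      rw [Complex.re_ofReal_mul, Complex.re_sum, integral_const_mul,
        integral_finsetSum (Finset.range (m + 1)) fun i _ ↦ (hTre e i).integrableOn]
      congr 1
      refine Finset.sum_congr rfl fun i _ ↦ ?_
      have := integral_re ((hTi e i).integrableOn (s := I₀))
      simpa only [RCLike.re_to_complex] using this.symm
    · exact ((integrable_finsetSum (Finset.range (m + 1)) fun i _ ↦ hTre e i).const_mul (w (e + 1))).integrableOn
  have hA : ∫ v in I₀, Φ v = μ * (∫ u, ‖g u‖ ^ 2) + P.re := by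
    rw [hnorm, hPre, hΦdef, integral_add, integral_const_mul]
    · exact ((integrable_finsetSum (Finset.range (m + 1)) fun i _ ↦ hNi i).const_mul μ).integrableOn
    · exact (integrable_finsetSum (Finset.range m) fun e _ ↦
        (integrable_finsetSum (Finset.range (m + 1)) fun i _ ↦ hTre e i).const_mul (w (e + 1))).integrableOn
  -- (B) Φ ≥ 0 on the base cell, from the certificate applied to the fibre vector
  have hB : ∀ v ∈ I₀, 0 ≤ Φ v := by
    intro v hv
    rw [hI₀, mem_Ico] at hv
    set G : ℤ → ℂ := fun n ↦ g (v + n * L) with hGdef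
    have hG1 : ∀ n : ℤ, n < 0 → G n = 0 := by
      intro n hn
      have hn' : (n : ℝ) ≤ -1 := by exact_mod_cast Int.le_sub_one_of_lt hn
      refine apply_eq_zero_of_not_mem hsupp fun h ↦ ?_
      rw [mem_Icc] at h
      nlinarith [h.1]
    have hG2 : ∀ n : ℤ, (m : ℤ) < n → G n = 0 := by
      intro n hn
      have hn' : (m : ℝ) + 1 ≤ n := by exact_mod_cast Int.add_one_le_of_lt hn
      refine apply_eq_zero_of_not_mem hsupp fun h ↦ ?_
      rw [mem_Icc] at h
      nlinarith [h.2]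
    have hc := hcert G hG1 hG2
    have hGi : ∀ i : ℕ, G i = g (v + i * L) := fun i ↦ by simp [hGdef]
    have hGm : ∀ i e : ℕ, G ((i : ℤ) - (e + 1)) = g (v + i * L - (e + 1) * L) := fun i e ↦ by
      simp only [hGdef]; push_cast; ring_nf
    have hGp : ∀ i e : ℕ, G ((i : ℤ) + (e + 1)) = g (v + i * L + (e + 1) * L) := fun i e ↦ by
      simp only [hGdef]; push_cast; ring_nf
    simp only [hGi, hGm, hGp] at hc
    simpa only [hΦdef, hTdef, hwdef] using hc
  have hpos : 0 ≤ ∫ v in I₀, Φ v := setIntegral_nonneg measurableSet_Ico hB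
  rw [hid, Complex.add_re]
  linarith [hA ▸ hpos]

/-! ## §5  Energy language -/

variable {P : (ℝ → ℂ) → Prop}

/-- **Energy form of the Toeplitz floor.** Under the fibre certificate of `re_weilSemilocalQuadratic_erase_ge_of_cert` with
`μ ≥ 0`: `λ_min(S∖{p}; c; P) ≥ λ_min(S; c; P) − μ` for every constraint `P`. -/
theorem semilocalGroundEnergy_erase_ge_of_cert {S : Finset ℕ} {p : ℕ} (hp : p.Prime) (hpS : p ∈ S) {c : ℝ} {m : ℕ}
    (hm : 2 * c < (m + 1) * Real.log p) {μ : ℝ} (hμ : 0 ≤ μ)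
    (hcert : ∀ G : ℤ → ℂ, (∀ n : ℤ, n < 0 → G n = 0) → (∀ n : ℤ, (m : ℤ) < n → G n = 0) →
      0 ≤ μ * ∑ i ∈ Finset.range (m + 1), ‖G i‖ ^ 2 +
        ∑ e ∈ Finset.range m, Real.log p / Real.sqrt ((p : ℝ) ^ (e + 1)) *
          ∑ i ∈ Finset.range (m + 1), (G i * conj (G ((i : ℤ) - (e + 1))) + G i * conj (G ((i : ℤ) + (e + 1)))).re) :
    semilocalGroundEnergy S P c - μ ≤ semilocalGroundEnergy (S.erase p) P c := by
  rcases (semilocalSphereValues (S.erase p) P c).eq_empty_or_nonempty with he | hne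
  · have he' : semilocalSphereValues S P c = ∅ := by
      rcases (semilocalSphereValues S P c).eq_empty_or_nonempty with h0 | h0
      · exact h0
      · have := (semilocalSphereValues_nonempty_iff S P c).1 h0
        rw [← semilocalSphereValues_nonempty_iff (S.erase p) P c, he] at this
        exact absurd this Set.not_nonempty_empty
    rw [semilocalGroundEnergy, semilocalGroundEnergy, he, he', Real.sInf_empty]
    linarith
  · refine le_semilocalGroundEnergy hne fun g hg hs hPg hn ↦ ?_
    have h1 := re_weilSemilocalQuadratic_erase_ge_of_cert hg hp hpS hs hm hcert
    have h2 := semilocalGroundEnergy_le_re (S := S) hg hs hPg hn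
    rw [hn, mul_one] at h1
    linarith

end Summit.RiemannHypothesis.RiemannHypothesis.Theorems.SemilocalDeletionToeplitzFloor

end
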